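import Literature.AlgebraicGeometry.Modules.PullbackAffineChart
import Literature.AlgebraicGeometry.Modules.IsoOfSectionsOnBasis
import Mathlib.Algebra.Category.Grp.Biproducts
import Mathlib.Algebra.Category.Grp.Limits
import Mathlib.CategoryTheory.Limits.Preserves.Shapes.Products
import HarnessLib

/-!
# `g^* g_* F ⟶ ∏_x τ_x^* F` — the comparison morphism attached to self-maps `τ x` of `X` over `Y`, its value on
pulled-back sections, and an isomorphism criterion on a basis (toward `IsogenyPullbackPushforwardDecomposition_holds`)

Research route conditional on HC_CM; not a corollary; Q11.4-sentence-2 already refuted in dim ≥ 3.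
(Context: cell pub-hodge-ring2, director-hodge g13 R13.62 (2) typing debt in support of `stmt-HodgeConjecture-26512`; this
file closes NO item.)  Everything here is general scheme theory (any `g : X ⟶ Y`, any family `τ : K → (X ⟶ X)` over `Y`);
it is the sheaf-level frame whose affine-chart matrix is the module Chase–Harrison–Rosenberg map `galoisProd` of
`Literature/RingTheory/GaloisAlgebras/ChaseHarrisonRosenbergModules.lean` [Greither1992CyclicGalois, Ch. 0 Thm. 1.6, Lemma 1.10].

References: D. Mumford, *Abelian Varieties* (1970), §7 Thm. 4 p. 72 and §12 Thm. 1 (descent along `X → X/K` for a free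
finite group action: `π^* π_* F ≅ ⊕_{x ∈ K} T_x^* F`) [MumfordAV1970]; C. Greither, LNM 1534 (1992), Ch. 0 [Greither1992CyclicGalois];
R. Hartshorne, GTM 52, II.5 p. 110 (`f^*`, `f_*`, adjunction) [Hartshorne1977].

WHAT IS PROVED (sorry-free):
* `piSections_bijective` — sections of a product of `𝒪_X`-modules over an open `W` are the product of the sections:
  `Γ(∏ N, W) → Π_x Γ(N x, W)`, `s ↦ (π_x s)_x` is bijective (the forgetful functor to presheaves and evaluation preserve limits).
* `isIso_piLift_of_bijective_on_basis` — `Pi.lift ψ : M ⟶ ∏ N` is an isomorphism as soon as `s ↦ (ψ_x s)_x` is bijective on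
  the opens of a basis.
* `toTwist g τ hτ F x : g^* g_* F ⟶ (τ x)^* F` (for `τ x ≫ g = g`) := `pullbackCongr ≫ pullbackComp⁻¹ ≫ (τ x)^*(ε_F)`, and its
  value on pulled-back sections: `toTwist … x` sends `η_g(m)|_W` to `η_{τ x}(m)|_W` (`toTwist_app_unitSectionLE`), where
  `m ∈ Γ(g_*F, V) = Γ(F, g⁻¹V)`.
* `toPi g τ hτ F := Pi.lift (toTwist …)` and `nonempty_iso_sigmaObj_of_isIso_toPi` — if `toPi` is an isomorphism and `K` is
  finite then `g^*g_*F ≅ ∐_x (τ x)^* F`.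
The chart computation (bijectivity of `s ↦ (toTwist_x s)_x` on affine charts from Chase–Harrison–Rosenberg data) is the next file.
-/

noncomputable section

open CategoryTheory CategoryTheory.Limits AlgebraicGeometry TopologicalSpace Opposite

universe u

namespace Literature.AlgebraicGeometry.Modules

/-! ## §1 Sections of a product of modules -/

section PiSections

variable {X : Scheme.{u}} {K : Type u} (N : K → X.Modules) (W : X.Opens)

/-- **Sections of a product are the product of the sections**: `s ↦ (π_x s)_x : Γ(∏ N, W) → Π_x Γ(N x, W)` is bijective
(Hartshorne: the direct product of `𝒪_X`-modules is the sectionwise product). [cite: Hartshorne1977, II Ex. 1.9 (p. 66) and II.5 (p. 109)] -/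
theorem piSections_bijective :
    Function.Bijective (fun s : Γ(∏ᶜ N, W) => fun x : K => (Pi.π N x).app W s) := by
  let G : X.Modules ⥤ Ab.{u} :=
    Scheme.Modules.toPresheaf X ⋙ (evaluation (X.Opens)ᵒᵖ Ab.{u}).obj (op W)
  haveI : PreservesLimitsOfSize.{u, u} G :=
    @comp_preservesLimits _ _ _ _ _ _ (Scheme.Modules.toPresheaf X) ((evaluation (X.Opens)ᵒᵖ Ab.{u}).obj (op W))
      inferInstance (evaluationPreservesLimits (op W))
  let E : G.obj (∏ᶜ N) ≅ (AddCommGrpCat.HasLimit.productLimitCone fun x => G.obj (N x)).cone.pt :=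
    PreservesProduct.iso G N ≪≫ limit.isoLimitCone (AddCommGrpCat.HasLimit.productLimitCone _)
  have hE : ∀ x : K,
      E.hom ≫ (AddCommGrpCat.HasLimit.productLimitCone fun x => G.obj (N x)).cone.π.app ⟨x⟩ =
        G.map (Pi.π N x) := by
    intro x
    simp only [E, Iso.trans_hom, Category.assoc, limit.isoLimitCone_hom_π, PreservesProduct.iso_hom]
    exact piComparison_comp_π G N x
  have hb : Function.Bijective (fun s : G.obj (∏ᶜ N) => fun x : K => (G.map (Pi.π N x)) s) := by
    have hfun : (fun s : G.obj (∏ᶜ N) => fun x : K => (G.map (Pi.π N x)) s) =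
        fun s => (E.hom : G.obj (∏ᶜ N) → (∀ x, G.obj (N x))) s := by
      funext s; funext x
      rw [← hE x]
      rfl
    rw [hfun]
    exact E.addCommGroupIsoToAddEquiv.bijective
  exact hb

/-- **Isomorphism onto a product, tested on a basis**: if `s ↦ (ψ_x s)_x : Γ(M, W) → Π_x Γ(N x, W)` is bijective for every
open `W` of a basis, then `Pi.lift ψ : M ⟶ ∏ N` is an isomorphism (isomorphism of sheaves is local; sheaves on a basis).
[cite: StacksProject, Tag 009U] [cite: Hartshorne1977, II Prop. 1.1 (p. 63)] -/
theorem isIso_piLift_of_bijective_on_basis {M : X.Modules} (ψ : ∀ x, M ⟶ N x) {B : Set X.Opens}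
    (hB : Opens.IsBasis B)
    (h : ∀ W ∈ B, Function.Bijective (fun s : Γ(M, W) => fun x : K => (ψ x).app W s)) :
    IsIso (Pi.lift ψ) := by
  refine isIso_of_bijective_on_basis (Pi.lift ψ) hB fun W hW => ?_
  have hcomp : (fun s : Γ(∏ᶜ N, W) => fun x : K => (Pi.π N x).app W s) ∘ (fun s => (Pi.lift ψ).app W s) =
      fun s => fun x => (ψ x).app W s := by
    funext s; funext x
    change (Pi.π N x).app W ((Pi.lift ψ).app W s) = _
    rw [← CategoryTheory.comp_apply, ← Scheme.Modules.Hom.comp_app, Pi.lift_π]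
  exact ((piSections_bijective N W).of_comp_iff' _).mp (hcomp ▸ h W hW)

end PiSections

/-! ## §2 The comparison morphism `g^* g_* F ⟶ (τ x)^* F` of a self-map over `Y` -/

section Twist

variable {X Y : Scheme.{u}} (g : X ⟶ Y) {K : Type u} (τ : K → (X ⟶ X)) (hτ : ∀ x, τ x ≫ g = g)
  (F : X.Modules)

/-- **The comparison map `g^* g_* F ⟶ (τ x)^* F`** for a self-map `τ x` of `X` over `Y` (`τ x ≫ g = g`):
`g^* g_* F = (τ x ≫ g)^* g_* F ≅ (τ x)^* g^* g_* F ⟶ (τ x)^* F`, the last map being `(τ x)^*` of the counit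
`ε_F : g^* g_* F ⟶ F`.  For an étale Galois cover with group `K` acting by `τ` these are the components of the classical
isomorphism `g^* g_* F ≅ ⊕_x (τ x)^* F` (Mumford, *Abelian varieties*, §7 Thm. 4, §12 Thm. 1); as a definition it is
plumbing of Mathlib's `pullbackCongr`, `pullbackComp` and the adjunction counit. [cite: Hartshorne1977, II.5 (p. 110)] -/
def toTwist (x : K) :
    (Scheme.Modules.pullback g).obj ((Scheme.Modules.pushforward g).obj F) ⟶ (Scheme.Modules.pullback (τ x)).obj F :=
  (Scheme.Modules.pullbackCongr (hτ x).symm).hom.app _ ≫ (Scheme.Modules.pullbackComp (τ x) g).inv.app _ ≫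
    (Scheme.Modules.pullback (τ x)).map ((Scheme.Modules.pullbackPushforwardAdjunction g).counit.app F)

/-- **The comparison map into the product** `g^* g_* F ⟶ ∏_x (τ x)^* F` (the tuple of the `toTwist … x`).
[cite: Hartshorne1977, II.5 (p. 110)] -/
def toPi : (Scheme.Modules.pullback g).obj ((Scheme.Modules.pushforward g).obj F) ⟶
    ∏ᶜ fun x => (Scheme.Modules.pullback (τ x)).obj F :=
  Pi.lift (toTwist g τ hτ F)

/-- The `x`-component of `toPi` is `toTwist … x`. [cite: Hartshorne1977, II.5 (p. 110)] -/
@[reassoc (attr := simp)]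
theorem toPi_π (x : K) : toPi g τ hτ F ≫ Pi.π _ x = toTwist g τ hτ F x := Pi.lift_π _ _

/-- The counit undoes the unit on sections: `ε_F(η_{g}(m)) = m` for `m ∈ Γ(g_*F, V) = Γ(F, g⁻¹V)` (a triangle identity of
the adjunction `g^* ⊣ g_*`). [cite: Hartshorne1977, II.5 (p. 110)] -/
theorem counit_app_unitSection (V : Y.Opens) (m : Γ((Scheme.Modules.pushforward g).obj F, V)) :
    ((Scheme.Modules.pullbackPushforwardAdjunction g).counit.app F).app (g ⁻¹ᵁ V)
      (unitSection g ((Scheme.Modules.pushforward g).obj F) V m) = m := by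
  have h := (Scheme.Modules.pullbackPushforwardAdjunction g).right_triangle_components F
  have h' := congrArg (fun φ => (Scheme.Modules.Hom.app φ V) m) h
  simp only [Scheme.Modules.Hom.comp_app, Scheme.Modules.pushforward_map_app] at h'
  exact h'

include hτ in
/-- The preimage of `V` under `τ x` over `g⁻¹V` is `g⁻¹V` again (`τ x ≫ g = g`). [cite: Hartshorne1977, II.5 (p. 110)] -/
theorem preimage_preimage_eq (x : K) (V : Y.Opens) : (τ x) ⁻¹ᵁ (g ⁻¹ᵁ V) = g ⁻¹ᵁ V := by
  rw [← Scheme.Hom.comp_preimage, hτ]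

/-- **`toTwist` on pulled-back sections**: `η_g(m) ↦ η_{τ x}(m)` (up to the identification of opens
`(τ x)⁻¹ g⁻¹ V = g⁻¹ V`; Hartshorne's `f^*` on the sections `m ⊗ 1`). [cite: Hartshorne1977, II.5 (p. 110)] -/
theorem toTwist_app_unitSection (x : K) (V : Y.Opens) (m : Γ((Scheme.Modules.pushforward g).obj F, V)) :
    (toTwist g τ hτ F x).app (g ⁻¹ᵁ V) (unitSection g ((Scheme.Modules.pushforward g).obj F) V m) =
      ((Scheme.Modules.pullback (τ x)).obj F).presheaf.map
        (eqToHom (preimage_preimage_eq g τ hτ x V).symm).op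
        (unitSection (τ x) F (g ⁻¹ᵁ V) (show Γ(F, g ⁻¹ᵁ V) from m)) := by
  simp only [toTwist, Scheme.Modules.Hom.comp_app, CategoryTheory.comp_apply]
  rw [pullbackCongr_hom_app_unitSection (M := (Scheme.Modules.pushforward g).obj F) (hτ x).symm V m,
    app_presheaf_map, app_presheaf_map]
  have h2 := pullbackComp_inv_app_unitSection g ((Scheme.Modules.pushforward g).obj F) (τ x) V m
  have h3 := pullback_map_app_unitSection (τ x)
    ((Scheme.Modules.pullbackPushforwardAdjunction g).counit.app F) (g ⁻¹ᵁ V)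
    (unitSection g ((Scheme.Modules.pushforward g).obj F) V m)
  rw [counit_app_unitSection] at h3
  erw [h2, h3]
  rfl

/-- **`toTwist` on restricted pulled-back sections**: for `W ⊆ g⁻¹V`, `η_g(m)|_W ↦ η_{τ x}(m)|_W`.
[cite: Hartshorne1977, II.5 (p. 110)] -/
theorem toTwist_app_unitSectionLE (x : K) {V : Y.Opens} {W : X.Opens} (i : W ≤ g ⁻¹ᵁ V)
    (m : Γ((Scheme.Modules.pushforward g).obj F, V)) :
    (toTwist g τ hτ F x).app W (unitSectionLE g ((Scheme.Modules.pushforward g).obj F) i m) =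
      unitSectionLE (τ x) F (i.trans (preimage_preimage_eq g τ hτ x V).ge) (show Γ(F, g ⁻¹ᵁ V) from m) := by
  simp only [unitSectionLE]
  rw [app_presheaf_map, toTwist_app_unitSection, ← CategoryTheory.comp_apply, ← Functor.map_comp]
  rfl

/-- **From the product to the coproduct**: if `toPi` is an isomorphism and `K` is finite, `g^* g_* F ≅ ∐_x (τ x)^* F`
(finite products of `𝒪_X`-modules are biproducts; this is the shape of Mumford's `π^* π_* F ≅ ⊕_x T_x^* F`).
[cite: MumfordAV1970, §7 Thm. 4 p. 72] [cite: Hartshorne1977, II Ex. 1.9 (p. 66)] -/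
theorem nonempty_iso_sigmaObj_of_isIso_toPi [Finite K] (h : IsIso (toPi g τ hτ F)) :
    Nonempty ((Scheme.Modules.pullback g).obj ((Scheme.Modules.pushforward g).obj F) ≅
      ∐ fun x => (Scheme.Modules.pullback (τ x)).obj F) := by
  haveI : HasFiniteBiproducts X.Modules := HasFiniteBiproducts.of_hasFiniteProducts
  exact ⟨asIso (toPi g τ hτ F) ≪≫ (biproduct.isoProduct _).symm ≪≫ biproduct.isoCoproduct _⟩

end Twist

end Literature.AlgebraicGeometry.Modules
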